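import Summits.ResolutionOfSingularities.ResolutionOfSingularities.Theorems.StallVertexLock
import Summits.ResolutionOfSingularities.ResolutionOfSingularities.Theorems.StallVertexNullClasses
import HarnessLib

/-!
# StallVertexLockClasses — decomp-res node «StallVertex» (lens-5 g23 rev 9), add-on tree file 3/4: THE TURN-LOCKED
POSITIVE LEAF (§4k cells, cone-free aside home)

Content VERBATIM from the decomp-res lens-5 tree-ready slices
`HOME/decomp-res-lens-5/g23/parts/StallVertexLock.lean` (fe40ed9c) /
`StallVertexLockClasses.lean` (05ee4541) of the node file `g23/StallVertex.lean` rev 9 (pin fbb7fe50 = rev 8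
9799ca34 + four pure insertions
§1l / §3j / §4k; critic machine diff, CRITIC-LEDGER row 162 DECIDED +1: THE TURN LOCK; HOME =
run/shared/lean/pub/decomp-res; landing order
INBOX :609 / :618).  Landed by decomp-res writer g9 as `StallVertexLockAlgebra` (§1l), `StallVertexLock` (§3j),
`StallVertexLockClasses`
(§4k cells and exact re-locations, cone-free) and the wiring file `MaxContactCutStallVertexLock` (§4k chain to the
target BY NAME); the 420-line
slice is split only to respect the 400-line file cap, declarations and proofs byte-identical.

The interference sub-cell law of window 142h (I), rule (C): the typed sub-cell `NoSecondTurnPositiveSkewStalledTailsDeep`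
(positive leaf's binders VERBATIM + i.o. a second chart change inside the untranslated run after an interference) is
PROVED EMPTY; the positive leaf `NoPositiveSkewStalledTailsDeep` is re-located EXACTLY to the turn-locked positive leaf
`NoTurnLockedPositiveSkewStalledTailsDeep`; the chain to the target BY NAME (`defectWalksDeep_iff_turnLocked_nullFlat`,
`closes_turnLocked_nullFlat`) needs the rev-8 §4i/§4j theorems `defectWalksDeep_iff_positive_nullFlat`,
`skew_iff_positive_nullFlat`, `closes_positive_nullFlat` (node file §4j; land those first or drop the last three theorems).
-/

noncomputable section

open MvPolynomial Finset
open Literature.AlgebraicGeometry.Resolution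
open Literature.AlgebraicGeometry.Resolution.Hauser2010
open Literature.AlgebraicGeometry.Resolution.HauserPerlega2024
open Literature.Barriers.ResolutionOfSingularities
open Literature.AlgebraicGeometry.Resolution.PointBlowup
open Summit.ResolutionOfSingularities.ResolutionOfSingularities.Theses
open Summit.ResolutionOfSingularities.ResolutionOfSingularities.Theorems.TightDefectClasses
open Summit.ResolutionOfSingularities.ResolutionOfSingularities.Theorems.ProximityCut
open Summit.ResolutionOfSingularities.ResolutionOfSingularities.Theorems.ExitLaw
open Summit.ResolutionOfSingularities.ResolutionOfSingularities.Theorems.DifferentialShade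

namespace Summit.ResolutionOfSingularities.ResolutionOfSingularities.Theorems.StallVertex

section Classes

/-! ### §4k (rev 9, generation 23) THE TURN-LOCKED POSITIVE LEAF (interference sub-cell law, rule (C)) -/

/-- DECIDED CLASS (rev 9): **NO SECOND-TURN POSITIVE TAILS** — the positive leaf's binders VERBATIM + «infinitely often
a SECOND TURN IN THE UNTRANSLATED RUN after an interference» (`SecondTurnAt`: unclean at `t`, an untranslated chart
change to `j'` at `t + 1`, and a chart `≠ j'` at some move `t + 1 + k` of the untranslated run `t + 1, …, t + 1 + k`).
EMPTY by the turn-lock chain.  Census (T-twolayer universe 4 867 stalled unclean stages / 3 807 positive; lock desk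
census g23, `desk/lock_census.py`): the entrance «interference, then a STALLED untranslated turn» occurs 36 times (purity
of the cone in `u_{j'}` 36/36, transport of both layers 36/36); recorded continuations of the untranslated run: 4
stalled same-chart repeats (each then a leaf), 2 SECOND TURNS — BOTH DROPS (R:A:2,4:15156 node 8, R:A:2,4:17621 node 10:
the law forcing the drop on record), 30 leaves; stalled second turns 0 (the law).  [new] -/
def NoSecondTurnPositiveSkewStalledTailsDeep : Prop :=
  ∀ p : ℕ, p.Prime → ∀ e : ℕ, 2 ≤ e → ∀ (K : Type) [Field K] [CharP K p] [PerfectField K] [DecidableEq K]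
    (s₀ : State (Fin 3) K), IsRoot (p ^ e) s₀ → ∀ W : ForcedWalk (p ^ e) s₀, (∀ i, 1 ≤ (W.st i).shade) →
    ∀ N : ℕ, (∀ t, N ≤ t → (W.st (t + 1)).shade = (W.st t).shade) →
    (∀ t, N ≤ t → ordZero (W.st t).F ≠ ((p ^ e : ℕ) : ℕ∞)) →
    (∀ M : ℕ, ∃ t, M ≤ t ∧ StaysOnNewest W t) → (∀ M : ℕ, ∃ t, M ≤ t ∧ W.b t ≠ 0) →
    (∀ (k : Fin 3) (N' : ℕ), ∃ t, N' ≤ t ∧ (W.j t = k ∨ W.b t k ≠ 0)) →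
    (∀ t, N ≤ t → (ifp W (t + 1)).muTilde (p ^ e) = (ifp W t).muTilde (p ^ e)) →
    (∀ t, N ≤ t → VertexLawEqAt W t) → (∀ t, N ≤ t → OriginLawAt W t) →
    (∀ (s : ℕ) (c : Fin 3 → K), ¬ ContactLineFrom W s c) →
    (0 : WithTop ℚ) < (ifp W N).muTilde (p ^ e) → (∀ M : ℕ, ∃ t, M ≤ t ∧ SecondTurnAt W t) → False

/-- The second-turn positive class is EMPTY (turn-lock chain). -/
theorem noSecondTurnPositiveSkewStalledTailsDeep_holds : NoSecondTurnPositiveSkewStalledTailsDeep := by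
  intro p hp e _ K _ _ _ _ s₀ hs W _ N _ _ _ _ _ hstall _ _ _ _ hD
  obtain ⟨t, ht, hdt⟩ := hD N
  exact not_secondTurnAt_of_stall hp hs W N hstall t ht hdt

/-- LOCATED RESIDUAL (rev 9, EXACT): **THE TURN-LOCKED POSITIVE TAILS** — the positive leaf's binders VERBATIM + the
TURN LOCK from `N` on: after every interference at `t ≥ N` followed by an untranslated chart change to `j'` at `t + 1`,
every move of the untranslated run `t + 1, …, t + 1 + k` is in chart `j'` (the untranslated walk turns AT MOST ONCE
between an interference and the next translation).  The new binder is DERIVABLE from the stall (`turn_lock_chain`) — it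
is put on record so that the next seat works the located class: around each of its (forced, `unclean_io_of_muTilde_pos`)
interferences the word of a positive tail reads «translate» or «turn once to `j'`, repeat `j'`, …, translate». -/
def NoTurnLockedPositiveSkewStalledTailsDeep : Prop :=
  ∀ p : ℕ, p.Prime → ∀ e : ℕ, 2 ≤ e → ∀ (K : Type) [Field K] [CharP K p] [PerfectField K] [DecidableEq K]
    (s₀ : State (Fin 3) K), IsRoot (p ^ e) s₀ → ∀ W : ForcedWalk (p ^ e) s₀, (∀ i, 1 ≤ (W.st i).shade) →
    ∀ N : ℕ, (∀ t, N ≤ t → (W.st (t + 1)).shade = (W.st t).shade) →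
    (∀ t, N ≤ t → ordZero (W.st t).F ≠ ((p ^ e : ℕ) : ℕ∞)) →
    (∀ M : ℕ, ∃ t, M ≤ t ∧ StaysOnNewest W t) → (∀ M : ℕ, ∃ t, M ≤ t ∧ W.b t ≠ 0) →
    (∀ (k : Fin 3) (N' : ℕ), ∃ t, N' ≤ t ∧ (W.j t = k ∨ W.b t k ≠ 0)) →
    (∀ t, N ≤ t → (ifp W (t + 1)).muTilde (p ^ e) = (ifp W t).muTilde (p ^ e)) →
    (∀ t, N ≤ t → VertexLawEqAt W t) → (∀ t, N ≤ t → OriginLawAt W t) →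
    (∀ (s : ℕ) (c : Fin 3 → K), ¬ ContactLineFrom W s c) →
    (0 : WithTop ℚ) < (ifp W N).muTilde (p ^ e) →
    (∀ t, N ≤ t → ¬ CleanAt W t → (∀ i, W.b (t + 1) i = 0) → W.j (t + 1) ≠ W.j t →
      ∀ k, (∀ i, i ≤ k → ∀ l, W.b (t + 1 + i) l = 0) → ∀ i, i ≤ k → W.j (t + 1 + i) = W.j (t + 1)) → False

/-- **EXACT RE-LOCATION**: positive leaf `↔` turn-locked positive leaf (the lock binder is discharged by
`turn_lock_chain`). -/
theorem positive_iff_turnLocked : NoPositiveSkewStalledTailsDeep ↔ NoTurnLockedPositiveSkewStalledTailsDeep := by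
  constructor
  · intro h p hp e he K _ _ _ _ s₀ hs W hsh N hplat hexc hS hT hskew hstall hrig horig hlf hpos _
    exact h p hp e he K s₀ hs W hsh N hplat hexc hS hT hskew hstall hrig horig hlf hpos
  · intro h p hp e he K _ _ _ _ s₀ hs W hsh N hplat hexc hS hT hskew hstall hrig horig hlf hpos
    exact h p hp e he K s₀ hs W hsh N hplat hexc hS hT hskew hstall hrig horig hlf hpos
      fun t ht hunc _ hj₁ k hbs => turn_lock_chain hp hs W t (hstall t ht) hunc hj₁ k
        (fun i _ => hstall (t + 1 + i) (by omega)) hbs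

/-- **EXACT SPLIT** of the positive leaf: (second-turn sub-cell, EMPTY) `∧` (turn-locked residual). -/
theorem positive_iff_secondTurn_turnLocked : NoPositiveSkewStalledTailsDeep ↔
    NoSecondTurnPositiveSkewStalledTailsDeep ∧ NoTurnLockedPositiveSkewStalledTailsDeep := by
  rw [positive_iff_turnLocked]
  exact ⟨fun h => ⟨noSecondTurnPositiveSkewStalledTailsDeep_holds, h⟩, fun h => h.2⟩

/-- `skew_iff_turnLocked_nullFlat`: Auxiliary step of this node's calculus, VERBATIM from the lens file (see the
module docstring); the statement is its type. [folklore] -/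
theorem skew_iff_turnLocked_nullFlat :
    CoefficientCut.NoSkewJointTailsDeep ↔ NoTurnLockedPositiveSkewStalledTailsDeep ∧ NoNullFlatSkewStalledTailsDeep := by
  rw [skew_iff_positive_nullFlat, positive_iff_turnLocked]

end Classes

end Summit.ResolutionOfSingularities.ResolutionOfSingularities.Theorems.StallVertex
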